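import Literature.IUT.HodgeTheaters.InitialThetaDataPlaces
import Literature.NumberTheory.EllipticCurves.DivisionField
import Literature.NumberTheory.EllipticCurves.TorsionRationalSemistableProofs
import HarnessLib

/-!
# [IUTchI] Definition 3.1: a SMART CONSTRUCTOR of initial Θ-data from its ARITHMETIC clauses
# (a)(b)(c)(e), with `K := F(E_F[l])` the `l`-division field and `V̲` a chosen section of `V(K) ↠ V_mod`

S. Mochizuki, *Inter-universal Teichmüller theory I*, RIMS manuscript (May 2020; = PRIMS **57** (2021)),
Def. 3.1 (a)–(f), kurims pp. 61–63 (read on the page); [IUTchIV] Cor. 2.2 (ii), proof, p. 46: "there exist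
data `C̲_K`, `V̲`, `ε̲` such that all of the conditions of [IUTchI], Definition 3.1, (a), (b), (c), (d), (e),
(f), are satisfied" — the step (P7) by which the route `Summit.ABC.ABC.Theses.IUTThetaPilot` (crux
`ThetaPartII`, layer-2 child (i) «ThetaDataExists(P, l)», route definition item D1) needs an INHABITANT of
the tree's hypothesis structure `InitialThetaData F K Fbar E l Pb` (`InitialThetaData.lean`, abc-iut-L5-t2).

This file does the part of (P7) that is CLASSICAL and needs no deep input: given
* a number field `F` with `√−1 ∈ F`, an elliptic curve `E/F` whose `F̄`-points killed by `30` are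
  `F`-rational (⟹ (b) "stable reduction at all `v ∈ V(F)^non`", by the tree's Raynaud/Silverman criterion
  `isSemistable_of_torsion_rational_fifteen`, abc-iut-S5; and "the `2·3`-torsion points are rational"),
  `F/F_mod` Galois of degree prime to `l` (HYPOTHESIS — by FLAG CANDIDATE F4 of the cell (F-L5t7-1) this is
  NOT automatic for the printed `F = F_tpd(√−1, E^Leg[3·5])` of [IUTchIV] Thm. 1.10 p. 22; the route owner's
  ruling (abc-iut-plan 2026-08-25T23:31:36Z) instantiates with `E_F := W ⊗ F`, `W` an `F_mod`-model and
  `F := F_mod(√−1, W[2·3·5])`, which IS Galois — see the instantiation file),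
* a prime `l ≥ 5` with `SL₂(𝔽_l) ⊆ Im(G_F → GL₂(𝔽_l))` ((c); HYPOTHESIS, the (P6) input) and the bad-place
  data `V^bad_mod` with its printed side conditions ((b),(c): nonempty, odd residue characteristic, bad
  multiplicative reduction over it, `l` prime to it and to the local heights; HYPOTHESES, the (P2)/(P5) inputs),
* the INTERFACE pieces: the `π₁`-geometry `ThetaGeometry` of (b),(d),(f) and the two local predicates of
  (e),(f) at bad places (`BadPlacePredicates`; FACT-policy boundary — tempered/étale `π₁`, [EtTh] Def. 2.5),
it CONSTRUCTS the datum with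
* (a) `F̄ := AlgebraicClosure F` (`IsAlgClosure` by instance);
* (c) **`K := F(E_F[l]) ⊆ F̄`, the `l`-division field** — the tree's `WeierstrassCurve.divisionField`
  (`DivisionField.lean`: the fixed field of the kernel of `G_F` on `E[l](F̄)`, finite Galois over `F`), a
  number field in the tower `F ⊆ K ⊆ F̄`, with `range_K_iff` = `mem_divisionField_iff` ("`K` … determined by the
  kernel of this homomorphism", p. 62);
* (e) **`V̲ := the image of a SECTION of `V(K) ↠ V_mod`** (surjective: `Val.restrict_surjective` twice,
  `InitialThetaDataPlaces.lean`) — "a subset that induces a natural bijection `V̲ ⥲ V_mod`", `V_bijOn` PROVED.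
So after this file an inhabitant of `InitialThetaData` for a concrete `(F, E, l)` costs exactly: the listed
arithmetic hypotheses (all about `F`, `E`, `l`, `V^bad_mod`) + the geometry interface. Nothing here takes a
side on [IUTchIII] Cor. 3.12; no printed statement is strengthened or asserted.
-/

noncomputable section

namespace Literature.IUT.HodgeTheaters

open NumberField IsDedekindDomain Field
open scoped WeierstrassCurve.Affine Classical

universe u

variable {F : Type u} [Field F] [NumberField F] (E : WeierstrassCurve F) [E.IsElliptic] (l : ℕ)

/-! ## (c) The `l`-division field `K = F(E_F[l])` as the middle of the tower `F ⊆ K ⊆ F̄` -/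

/-- `K := F(E_F[l]) ⊆ F̄ = AlgebraicClosure F` ("`K ⊆ F̄` … the finite Galois extension of `F` determined by
the kernel of [`G_F → GL₂(𝔽_l)`]", Def. 3.1 (c), p. 62), as a TYPE: the tree's `l`-division field.
[claim: Mochizuki2012, status: disputed] -/
abbrev TorsionField : Type u := ↥(E.divisionField l)

/-- `K = F(E_F[l])` is a number field (finite over the number field `F`). Def. 3.1 (c).
[claim: Mochizuki2012, status: disputed] -/
instance TorsionField.instNumberField [NeZero l] : NumberField (TorsionField E l) :=
  NumberField.of_module_finite F (TorsionField E l)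

omit [NumberField F] [E.IsElliptic] in
/-- The printed characterisation of `K` (Def. 3.1 (c)): an element of `F̄` lies in (the image of) `K` iff it
is fixed by every `σ ∈ G_F` acting trivially on the `l`-torsion `E_F[l](F̄)` — the field `range_K_iff` of
`InitialThetaData`, here a THEOREM (`WeierstrassCurve.mem_divisionField_iff`). [claim: Mochizuki2012, status: disputed] -/
theorem TorsionField.range_iff (x : AlgebraicClosure F) :
    x ∈ Set.range (algebraMap (TorsionField E l) (AlgebraicClosure F)) ↔
      ∀ σ : AlgebraicClosure F ≃ₐ[F] AlgebraicClosure F, FixesTorsion E l σ → σ x = x := by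
  have hrange : x ∈ Set.range (algebraMap (TorsionField E l) (AlgebraicClosure F)) ↔
      x ∈ E.divisionField l := by
    constructor
    · rintro ⟨y, rfl⟩
      exact y.2
    · intro hx
      exact ⟨⟨x, hx⟩, rfl⟩
  rw [hrange, WeierstrassCurve.mem_divisionField_iff]
  have key : ∀ σ : absoluteGaloisGroup F,
      (∀ T : WeierstrassCurve.geomTorsion E (l : ℤ), σ • T = T) ↔ FixesTorsion E l σ := by
    intro σ
    constructor
    · intro h P hP
      have hmem : P ∈ WeierstrassCurve.geomTorsion E (l : ℤ) :=
        (Submodule.mem_torsionBy_iff (l : ℤ) P).mpr hP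
      have := h ⟨P, hmem⟩
      have hc := congrArg Subtype.val this
      rw [Literature.NumberTheory.EllipticCurves.AddSubgroup.torsionBy.coe_smul] at hc
      exact hc
    · intro h T
      apply Subtype.ext
      rw [Literature.NumberTheory.EllipticCurves.AddSubgroup.torsionBy.coe_smul]
      exact h T.1 ((Submodule.mem_torsionBy_iff (l : ℤ) T.1).mp T.2)
  constructor
  · intro h σ hσ
    exact h σ ((key σ).mpr hσ)
  · intro h σ hσ
    exact h σ ((key σ).mp hσ)

/-! ## (e) `V̲`: a section of `V(K) ↠ V_mod` -/

section Section
variable (K : Type u) [Field K] [NumberField K] [Algebra F K]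

/-- The restriction `V(K) → V_mod` is surjective (every valuation of `F_mod` extends to `K`): the composite of
the two surjections `V(K) ↠ V(F) ↠ V(F_mod)` (`Val.restrict_surjective`). Def. 3.1 (e) "the natural
surjection `V(K) ↠ V_mod`". [claim: Mochizuki2012, status: disputed] -/
theorem toVMod_surjective : Function.Surjective (toVMod F K E) := by
  intro u
  obtain ⟨v, rfl⟩ := Val.restrict_surjective (fieldOfModuli E) (M := F) u
  obtain ⟨w, rfl⟩ := Val.restrict_surjective F (M := K) v
  exact ⟨w, rfl⟩

/-- A SECTION `V_mod → V(K)` of the restriction of valuations (a choice, as in print: "`V̲ ⊆ V(K)` is a subset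
that induces a natural bijection `V̲ ⥲ V_mod`, i.e., a section of the natural surjection `V(K) ↠ V_mod`",
Def. 3.1 (e)). [claim: Mochizuki2012, status: disputed] -/
def vSection : Val (fieldOfModuli E) → Val K := Function.surjInv (toVMod_surjective E K)

/-- The section is a section: `v̲ ↦ v`. [claim: Mochizuki2012, status: disputed] -/
theorem toVMod_vSection (v : Val (fieldOfModuli E)) : toVMod F K E (vSection E K v) = v :=
  Function.surjInv_eq (toVMod_surjective E K) v

/-- `V̲ :=` the image of the section. [claim: Mochizuki2012, status: disputed] -/
def VSection : Set (Val K) := Set.range (vSection E K)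

/-- `V̲ ⥲ V_mod` is a bijection (Def. 3.1 (e)) — the field `V_bijOn` of `InitialThetaData`, PROVED for the
chosen section. [claim: Mochizuki2012, status: disputed] -/
theorem VSection_bijOn : Set.BijOn (toVMod F K E) (VSection E K) Set.univ := by
  refine ⟨fun _ _ => Set.mem_univ _, ?_, ?_⟩
  · rintro _ ⟨a, rfl⟩ _ ⟨b, rfl⟩ h
    rw [toVMod_vSection, toVMod_vSection] at h
    rw [h]
  · intro v _
    exact ⟨vSection E K v, ⟨v, rfl⟩, toVMod_vSection E K v⟩

end Section

/-! ## The arithmetic input of Def. 3.1 (a)(b)(c) in checkable form -/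

/-- The ARITHMETIC clauses of [IUTchI] Def. 3.1 (a)(b)(c) for `(F, E_F, l, V^bad_mod)`, each a checkable
statement about number fields / the curve (no `π₁`): (a) `√−1 ∈ F`; (b) the `F̄`-points of `E_F` killed by
`30` are `F`-rational (⟹ stable reduction everywhere and "the `2·3`-torsion points of `E_F` are rational over
`F`"; for the Θ-data of [IUTchIV] Cor. 2.2 (ii) this is "`F = F_mod(√−1, E_{F_mod}[2·3·5])`", Thm. 1.10
p. 22), `F/F_mod` Galois of degree prime to `l`, and `V^bad_mod`: nonempty, odd residue characteristics, bad
multiplicative reduction over it; (c) `l ≥ 5` prime, `SL₂(𝔽_l) ⊆` the image of `G_F` on `E_F[l]`, `l` prime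
to the residue characteristics of `V^bad_mod` and to the orders of the `q`-parameters at `V(F)^bad`.
[claim: Mochizuki2012, status: disputed] -/
structure ArithInput where
  /-- (a) `√−1 ∈ F` -/
  sqrt_neg_one_mem : ∃ i : F, i ^ 2 = -1
  /-- (b) the `F̄`-points of `E_F` killed by `30 = 2·3·5` are `F`-rational -/
  torsion_thirty_rational : ∀ P : GeomPoints (AlgebraicClosure F) E, (30 : ℤ) • P = 0 →
    P ∈ Set.range (WeierstrassCurve.Affine.Point.baseChange (W' := E.toAffine) F (AlgebraicClosure F))
  /-- (b) `V^bad_mod ⊆` the finite places of `F_mod` -/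
  VbadMod : Set (FinitePlace (fieldOfModuli E))
  /-- (b) `V^bad_mod ≠ ∅` -/
  VbadMod_nonempty : VbadMod.Nonempty
  /-- (b) odd residue characteristic -/
  VbadMod_odd : ∀ w ∈ VbadMod, Odd (residueChar w)
  /-- (b) bad multiplicative reduction at the places of `F` over `V^bad_mod` -/
  multiplicative_over_VbadMod : ∀ v : FinitePlace F,
    Val.restrict (fieldOfModuli E) (Val.non v) ∈ Val.non '' VbadMod →
      E.HasMultiplicativeReductionAt v.maximalIdeal
  /-- (b) `F/F_mod` is Galois (HYPOTHESIS; see FLAG CANDIDATE F4 / the module docstring) -/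
  isGalois_fieldOfModuli : IsGalois (fieldOfModuli E) F
  /-- (b) `[F : F_mod]` is prime to `l` -/
  finrank_coprime : (Module.finrank (fieldOfModuli E) F).Coprime l
  /-- (c) `l` is prime -/
  l_prime : l.Prime
  /-- (c) `l ≥ 5` -/
  five_le_l : 5 ≤ l
  /-- (c) `SL₂(𝔽_l) ⊆ Im(G_F → GL₂(𝔽_l))` on `E_F[l](F̄)` (HYPOTHESIS; the (P6) input) -/
  imageContainsSL2 : ImageContainsSL2 (AlgebraicClosure F) E l
  /-- (c) `l` is prime to the residue characteristics of `V^bad_mod` -/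
  l_ne_residueChar : ∀ w ∈ VbadMod, residueChar w ≠ l
  /-- (c) `l` is prime to the orders of the `q`-parameters at `V(F)^bad` -/
  l_coprime_qParamOrd : ∀ v : FinitePlace F,
    Val.restrict (fieldOfModuli E) (Val.non v) ∈ Val.non '' VbadMod → l.Coprime (qParamOrd E v.maximalIdeal)

namespace ArithInput

variable {E l}

/-- (b) "stable reduction over all `v ∈ V(F)^non`" FOLLOWS from the rationality of the `30`-torsion (points killed
by `15` are killed by `30`; `isSemistable_of_torsion_rational_fifteen`, [IUTchIV] Prop. 1.8 (v) real form,
abc-iut-S5). [claim: Mochizuki2012, status: disputed] -/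
theorem isSemistable (A : ArithInput E l) : E.IsSemistable (𝓞 F) := by
  refine E.isSemistable_of_torsion_rational_fifteen fun P hP => ?_
  -- `P : E.geomPoints` (the tree's synonym of abc-iut-S5's file) is definitionally a point of
  -- `E.toAffine.baseChange F̄`, i.e. an element of `GeomPoints F̄ E`; the scalar actions agree definitionally.
  have h30 : (30 : ℤ) • P = 0 := by
    rw [show (30 : ℤ) = 2 * 15 by norm_num, mul_smul, hP, smul_zero]
  exact A.torsion_thirty_rational P h30

/-- (b) "the `2·3`-torsion points of `E_F` are rational over `F`" FOLLOWS (points killed by `6` are killed by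
`30`). [claim: Mochizuki2012, status: disputed] -/
theorem torsion_six_rational (A : ArithInput E l) (P : GeomPoints (AlgebraicClosure F) E)
    (hP : (6 : ℤ) • P = 0) :
    P ∈ Set.range (WeierstrassCurve.Affine.Point.baseChange (W' := E.toAffine) F (AlgebraicClosure F)) := by
  refine A.torsion_thirty_rational P ?_
  rw [show (30 : ℤ) = 5 * 6 by norm_num, mul_smul, hP, smul_zero]

/-- `l ≠ 0`, for the instances on the division field. [claim: Mochizuki2012, status: disputed] -/
theorem neZero_l (A : ArithInput E l) : NeZero l := ⟨A.l_prime.ne_zero⟩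

end ArithInput

/-! ## The smart constructor -/

/-- **[IUTchI] Def. 3.1 from its arithmetic clauses + the geometry interface** (the (P7) step of [IUTchIV]
Cor. 2.2 (ii), p. 46, for whatever `(F, E_F, l, V^bad_mod)` satisfies the printed arithmetic conditions):
initial Θ-data `(F̄/F, X_F, l, C̲_K, V̲, V^bad_mod, ε̲)` with `F̄ := AlgebraicClosure F`, `K := F(E_F[l])` the
`l`-division field, `V̲ :=` the image of a section of `V(K) ↠ V_mod`, the `π₁`-geometry `geom` and the bad-place
predicates `Pb` (with their two printed clauses at the places over `V^bad_mod`) supplied as the INTERFACE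
arguments they are in `InitialThetaData`. Every non-interface field is PROVED here (`range_K_iff`,
`isSemistable`, `torsion_six_rational`, `V_bijOn`, the instances) or passed through from `ArithInput`.
[claim: Mochizuki2012, status: disputed] -/
def InitialThetaData.ofArith (A : ArithInput E l) [NeZero l]
    (Pb : BadPlacePredicates (TorsionField E l))
    (geom : ThetaGeometry.{u} (AlgebraicClosure F ≃ₐ[F] AlgebraicClosure F)
      (galoisSubgroupOf F (TorsionField E l) (AlgebraicClosure F)) l)
    (hbad_type : ∀ w : Val (TorsionField E l),
      toVMod F (TorsionField E l) E w ∈ Val.non '' A.VbadMod → Pb.IsTypeOneZModLPM w)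
    (hbad_cusp : ∀ w : Val (TorsionField E l),
      toVMod F (TorsionField E l) E w ∈ Val.non '' A.VbadMod → Pb.IsCanonicalGeneratorCusp w) :
    InitialThetaData F (TorsionField E l) (AlgebraicClosure F) E l Pb where
  sqrt_neg_one_mem := A.sqrt_neg_one_mem
  isSemistable := A.isSemistable
  VbadMod := A.VbadMod
  VbadMod_nonempty := A.VbadMod_nonempty
  VbadMod_odd := A.VbadMod_odd
  multiplicative_over_VbadMod := A.multiplicative_over_VbadMod
  isGalois_fieldOfModuli := A.isGalois_fieldOfModuli
  finrank_coprime := A.finrank_coprime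
  torsion_six_rational := A.torsion_six_rational
  l_prime := A.l_prime
  five_le_l := A.five_le_l
  imageContainsSL2 := A.imageContainsSL2
  range_K_iff := TorsionField.range_iff E l
  l_ne_residueChar := A.l_ne_residueChar
  l_coprime_qParamOrd := A.l_coprime_qParamOrd
  geom := geom
  V := VSection E (TorsionField E l)
  V_bijOn := VSection_bijOn E (TorsionField E l)
  bad_type := fun w _ hw => hbad_type w hw
  bad_cusp := fun w _ hw => hbad_cusp w hw

/-- The constructed datum has `V^bad_mod` as given. [claim: Mochizuki2012, status: disputed] -/
theorem InitialThetaData.ofArith_VbadMod (A : ArithInput E l) [NeZero l]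
    (Pb : BadPlacePredicates (TorsionField E l))
    (geom : ThetaGeometry.{u} (AlgebraicClosure F ≃ₐ[F] AlgebraicClosure F)
      (galoisSubgroupOf F (TorsionField E l) (AlgebraicClosure F)) l)
    (hbad_type : ∀ w : Val (TorsionField E l),
      toVMod F (TorsionField E l) E w ∈ Val.non '' A.VbadMod → Pb.IsTypeOneZModLPM w)
    (hbad_cusp : ∀ w : Val (TorsionField E l),
      toVMod F (TorsionField E l) E w ∈ Val.non '' A.VbadMod → Pb.IsCanonicalGeneratorCusp w) :
    (InitialThetaData.ofArith E l A Pb geom hbad_type hbad_cusp).VbadMod = A.VbadMod := rfl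

/-- The constructed datum has `V̲ =` the image of the chosen section. [claim: Mochizuki2012, status: disputed] -/
theorem InitialThetaData.ofArith_V (A : ArithInput E l) [NeZero l]
    (Pb : BadPlacePredicates (TorsionField E l))
    (geom : ThetaGeometry.{u} (AlgebraicClosure F ≃ₐ[F] AlgebraicClosure F)
      (galoisSubgroupOf F (TorsionField E l) (AlgebraicClosure F)) l)
    (hbad_type : ∀ w : Val (TorsionField E l),
      toVMod F (TorsionField E l) E w ∈ Val.non '' A.VbadMod → Pb.IsTypeOneZModLPM w)
    (hbad_cusp : ∀ w : Val (TorsionField E l),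
      toVMod F (TorsionField E l) E w ∈ Val.non '' A.VbadMod → Pb.IsCanonicalGeneratorCusp w) :
    (InitialThetaData.ofArith E l A Pb geom hbad_type hbad_cusp).V = VSection E (TorsionField E l) := rfl

/-- **Existence form** (the shape of the route's child (i) «ThetaDataExists»): from the arithmetic input and ANY
geometry interface datum with its bad-place clauses, initial Θ-data with the given `V^bad_mod` EXIST.
[claim: Mochizuki2012, status: disputed] -/
theorem InitialThetaData.exists_ofArith (A : ArithInput E l) [NeZero l]
    (Pb : BadPlacePredicates (TorsionField E l))
    (geom : ThetaGeometry.{u} (AlgebraicClosure F ≃ₐ[F] AlgebraicClosure F)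
      (galoisSubgroupOf F (TorsionField E l) (AlgebraicClosure F)) l)
    (hbad_type : ∀ w : Val (TorsionField E l),
      toVMod F (TorsionField E l) E w ∈ Val.non '' A.VbadMod → Pb.IsTypeOneZModLPM w)
    (hbad_cusp : ∀ w : Val (TorsionField E l),
      toVMod F (TorsionField E l) E w ∈ Val.non '' A.VbadMod → Pb.IsCanonicalGeneratorCusp w) :
    ∃ D : InitialThetaData F (TorsionField E l) (AlgebraicClosure F) E l Pb, D.VbadMod = A.VbadMod :=
  ⟨InitialThetaData.ofArith E l A Pb geom hbad_type hbad_cusp, rfl⟩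

/-! ## The packaged input forces `l ≥ 7` (audit note N1 of abc-iut-w5-d105 on this file, folded verbatim)

`ArithInput E l` asks for the `2·3·5`-torsion to be `F`-rational AND for `SL₂(𝔽_l) ⊆ Im(G_F → GL₂(𝔽_l))`
with `l ≥ 5`; at `l = 5` these are incompatible (rational `l`-torsion makes `G_F` act trivially on `E[l]`,
while the unipotent `(1 1; 0 1)` must be realised), so every inhabitant has `l ≥ 7` — harmless for
[IUTchIV] Cor. 2.2 (ii) (there `l ≥ h^{1/2} ≫ 5`; Thm. 1.10 p. 22 "`l ≠ 5`"), but worth stating: print's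
[IUTchI] Def. 3.1 (b)(c) alone (only `2·3`-torsion rational, `l ≥ 5`) does allow `l = 5`. -/

section SevenLe

variable {E l}

omit [NumberField F] [E.IsElliptic] in
/-- `F`-rational points of `E_F(F̄)` are fixed by every `σ ∈ G_F`. [cite: Mochizuki2012, IUTchI Def 3.1 (b) p.66] -/
theorem galoisAct_eq_self_of_mem_range
    (σ : AlgebraicClosure F ≃ₐ[F] AlgebraicClosure F) (P : GeomPoints (AlgebraicClosure F) E)
    (hP : P ∈ Set.range
      (WeierstrassCurve.Affine.Point.baseChange (W' := E.toAffine) F (AlgebraicClosure F))) :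
    galoisAct E σ P = P := by
  obtain ⟨P₀, rfl⟩ := hP
  exact WeierstrassCurve.Affine.Point.map_baseChange (W' := E.toAffine)
    (σ : AlgebraicClosure F →ₐ[F] AlgebraicClosure F) P₀

/-- Under `ArithInput E l`, every `σ ∈ G_F` fixes the `l`-torsion whenever `l ∣ 30`.
[cite: Mochizuki2012, IUTchI Def 3.1 (b) p.66] -/
theorem ArithInput.galoisAct_eq_self_of_dvd_thirty (A : ArithInput E l) (hl : (l : ℤ) ∣ 30)
    (σ : AlgebraicClosure F ≃ₐ[F] AlgebraicClosure F) (P : GeomPoints (AlgebraicClosure F) E)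
    (hP : (l : ℤ) • P = 0) : galoisAct E σ P = P := by
  refine galoisAct_eq_self_of_mem_range σ P (A.torsion_thirty_rational P ?_)
  obtain ⟨k, hk⟩ := hl
  rw [hk, mul_comm, mul_smul, hP, smul_zero]

/-- **The packaged input forces `l ∤ 30`** (the unipotent `(1 1; 0 1) ∈ SL₂(𝔽_l)` is a Galois element by
`ImageContainsSL2`, but acts trivially if `E[l]` is rational). [cite: Mochizuki2012, IUTchI Def 3.1 (c) p.66] -/
theorem ArithInput.not_dvd_thirty (A : ArithInput E l) : ¬ (l : ℤ) ∣ 30 := by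
  intro hl
  obtain ⟨P, Q, hP, hQ, hindep, -, hreal⟩ := A.imageContainsSL2.exists_basis
  -- the unipotent matrix `(a b; c d) = (1 1; 0 1)`
  obtain ⟨σ, -, hσQ⟩ := hreal 1 1 0 1 (by norm_num)
  have hfix : galoisAct E σ Q = Q := A.galoisAct_eq_self_of_dvd_thirty hl σ Q hQ
  rw [hfix] at hσQ
  simp only [one_smul] at hσQ
  -- so `P = 0`
  have hP0 : P = 0 := by
    have h := congrArg (· - Q) hσQ
    simpa using h.symm
  have h1 : (l : ℤ) ∣ 1 := (hindep 1 0 (by rw [hP0]; simp)).1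
  have hl5 : (5 : ℤ) ≤ l := by exact_mod_cast A.five_le_l
  have := Int.le_of_dvd one_pos h1
  omega

/-- **`ArithInput E l → 7 ≤ l`** (`l` prime, `l ≥ 5`, `l ∤ 30`; [IUTchIV] Thm. 1.10 p. 22: "`l ≠ 5`").
[cite: Mochizuki2012, IUTchIV Thm 1.10 p.22] -/
theorem ArithInput.seven_le (A : ArithInput E l) : 7 ≤ l := by
  have h5 := A.five_le_l
  have hprime := A.l_prime
  have hnd := A.not_dvd_thirty
  rcases Nat.lt_or_ge l 7 with hlt | hge
  · interval_cases l
    · exact absurd (by norm_num) hnd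
    · exact absurd hprime (by norm_num)
  · exact hge

/-- In particular `ArithInput E 5` is uninhabited. [cite: Mochizuki2012, IUTchIV Thm 1.10 p.22] -/
theorem ArithInput.isEmpty_five : IsEmpty (ArithInput E 5) :=
  ⟨fun A => by have := A.seven_le; omega⟩

end SevenLe

end Literature.IUT.HodgeTheaters

end
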